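import Literature.Topology.FourManifolds.TimeDependentFlow
import HarnessLib

/-!
# A time-dependent vector field with compact space-support generates an ambient isotopy

Topic `Literature/Topology/FourManifolds`.  M. W. Hirsch, *Differential Topology* (1976), Ch. 8
§1, Thm. 1.2: *"A time-dependent vector field which has compact support generates an isotopy"*,
on a Hausdorff manifold **without boundary, not necessarily compact**.  The tree has the case of
a compact manifold (`exists_ambientIsotopy_of_timeDependent`, `TimeDependentFlow.lean`) and the
autonomous compactly supported case (`CompactSupportFlow.lean`); this file does the
time-dependent compactly supported case, needed for the flows of velocity fields of isotopies of
solids in `ℝ³` (thick alignment of ball parametrisations in the proof of the smooth Schönflies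
theorem, Schultens (2014), Thm. 3.2.5 / Lemma 3.2.3).

* `hasUniformLocalFlow_suspension_of_isCompact` — if `G` vanishes off the slab `[a, b] × K`
  (`K` compact) then the suspension field `X = (1, G)` on `ℝ × N` has uniform local flows: the
  compact slab `[a-1, b+1] × K` is covered by finitely many local flow boxes, and off it the
  horizontal lines are integral curves for unit time.
* `exists_ambientIsotopy_of_timeDependent_of_isCompact` — the generated ambient isotopy `Ψ`
  (`suspensionIsotopy`), all of whose tracks are integral curves of `X`;
* `AmbientIsotopy.apply_eq_self_of_forall_eq_zero` — points where the field vanishes at all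
  times do not move; `AmbientIsotopy.apply_eq_of_track` — a curve whose track is an integral
  curve is carried by `Ψ`.

## References
* M. W. Hirsch, *Differential Topology*, GTM 33, Springer (1976), Ch. 8 §1, Thms. 1.1–1.2.
* J. M. Lee, *Introduction to Smooth Manifolds*, 2nd ed. (2012), Thm. 9.16.
-/

open scoped Manifold ContDiff Topology
open Set Function Filter

noncomputable section

namespace Literature.Topology.FourManifolds

namespace SlabFlow

variable {EN : Type*} [NormedAddCommGroup EN] [NormedSpace ℝ EN]
  {HN : Type*} [TopologicalSpace HN] {J : ModelWithCorners ℝ EN HN}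
  {N : Type*} [TopologicalSpace N] [ChartedSpace HN N]
  {X : Π p : ℝ × N, TangentSpace (𝓘(ℝ, ℝ).prod J) p} {a b : ℝ}

variable [IsManifold J ∞ N] [T2Space N] [BoundarylessManifold J N]

/-- **Uniform time of existence for a suspension field with compact space-support**: if
`X = (1, G)` on `ℝ × N` (no boundary, any `N`) and `G` vanishes off `[a, b] × K` with `K`
compact, then `X` has uniform local flows — finitely many local flows cover the compact slab
`[a-1, b+1] × K`, and off it the horizontal lines `s ↦ (t + s, y)`, `|s| < 1`, are integral
curves. [cite: HirschDT1976, Ch. 8 §1, Thms. 1.1–1.2] -/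
theorem hasUniformLocalFlow_suspension_of_isCompact [CompleteSpace EN]
    (hX : ContMDiff (𝓘(ℝ, ℝ).prod J) (𝓘(ℝ, ℝ).prod J).tangent ∞
      fun p => (⟨p, X p⟩ : TangentBundle (𝓘(ℝ, ℝ).prod J) (ℝ × N)))
    (hX1 : ∀ p, (X p).1 = 1) {K : Set N} (hK : IsCompact K)
    (hsupp : ∀ p : ℝ × N, (p.1 ∉ Icc a b ∨ p.2 ∉ K) → (X p).2 = 0) :
    ∃ ε > (0 : ℝ), HasUniformLocalFlow (𝓘(ℝ, ℝ).prod J) X ε := by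
  classical
  have hloc : ∀ p : ℝ × N, ∃ U : Set (ℝ × N), IsOpen U ∧ p ∈ U ∧ ∃ ε > (0 : ℝ),
      ∃ Φ : (ℝ × N) → ℝ → ℝ × N, (∀ x ∈ U, Φ x 0 = x) ∧
      (∀ x ∈ U, IsMIntegralCurveOn (Φ x) X (Ioo (-ε) ε)) ∧
      ContMDiffOn (((𝓘(ℝ, ℝ)).prod J).prod 𝓘(ℝ, ℝ)) ((𝓘(ℝ, ℝ)).prod J) ∞
        (fun q : (ℝ × N) × ℝ => Φ q.1 q.2) (U ×ˢ Ioo (-ε) ε) :=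
    fun p => exists_contMDiffOn_localFlow hX BoundarylessManifold.isInteriorPoint
  choose U hUo hpU ε hε Φ hΦ0 hΦc hΦs using hloc
  set S : Set (ℝ × N) := Icc (a - 1) (b + 1) ×ˢ K with hS_def
  have hS : IsCompact S := isCompact_Icc.prod hK
  obtain ⟨T, hT⟩ := hS.elim_finite_subcover U hUo fun x _ => mem_iUnion.2 ⟨x, hpU x⟩
  obtain ⟨ε₀, hε₀, hε₀1, hε₀T⟩ : ∃ ε₀ : ℝ, 0 < ε₀ ∧ ε₀ ≤ 1 ∧ ∀ i ∈ T, ε₀ ≤ ε i := by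
    rcases T.eq_empty_or_nonempty with hTe | hTne
    · exact ⟨1, one_pos, le_rfl, fun i hi => by simp [hTe] at hi⟩
    · refine ⟨min 1 (T.inf' hTne ε), lt_min one_pos ((Finset.lt_inf'_iff hTne).2 fun i _ => hε i),
        min_le_left _ _, fun i hi => (min_le_right _ _).trans (Finset.inf'_le _ hi)⟩
  refine ⟨ε₀, hε₀, fun x₀ => ?_⟩
  by_cases hxS : x₀ ∈ S
  · obtain ⟨i, hi, hx₀i⟩ := mem_iUnion₂.1 (hT hxS)
    have hIoo : Ioo (-ε₀) ε₀ ⊆ Ioo (-ε i) (ε i) := fun t ht =>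
      ⟨lt_of_le_of_lt (neg_le_neg (hε₀T i hi)) ht.1, lt_of_lt_of_le ht.2 (hε₀T i hi)⟩
    exact ⟨U i, hUo i, hx₀i, Φ i, hΦ0 i, fun x hx => (hΦc i x hx).mono hIoo,
      (hΦs i).mono (prod_mono Subset.rfl hIoo)⟩
  · -- off the slab: horizontal lines
    set V : Set (ℝ × N) := ((Iio (a - 1) ∪ Ioi (b + 1)) ×ˢ univ) ∪ (univ ×ˢ Kᶜ) with hV_def
    have hVo : IsOpen V :=
      ((isOpen_Iio.union isOpen_Ioi).prod isOpen_univ).union (isOpen_univ.prod hK.isClosed.isOpen_compl)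
    have hx₀V : x₀ ∈ V := by
      simp only [hS_def, mem_prod, mem_Icc, not_and_or, not_le] at hxS
      rcases hxS with (h | h) | h
      · exact Or.inl ⟨Or.inl h, mem_univ _⟩
      · exact Or.inl ⟨Or.inr h, mem_univ _⟩
      · exact Or.inr ⟨mem_univ _, h⟩
    refine ⟨V, hVo, hx₀V, fun p s => (p.1 + s, p.2), fun p _ => by simp, fun p hp s hs => ?_,
      contMDiff_horizontal.contMDiffOn⟩
    have hs1 : -1 < s ∧ s < 1 := ⟨by linarith [hs.1], by linarith [hs.2]⟩
    have hout : (p.1 + s, p.2).1 ∉ Icc a b ∨ (p.1 + s, p.2).2 ∉ K := by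
      rcases hp with ⟨hp1, -⟩ | ⟨-, hp2⟩
      · left
        rcases hp1 with h | h
        · simp only [mem_Iio] at h
          exact fun hm => by linarith [hm.1]
        · simp only [mem_Ioi] at h
          exact fun hm => by linarith [hm.2]
      · exact Or.inr hp2
    exact (hasMFDerivAt_horizontal hX1 (hsupp _ hout)).hasMFDerivWithinAt

/-- **A time-dependent vector field with compact space-support generates an ambient isotopy**
(Hirsch (1976), Ch. 8 §1, Thm. 1.2).  `N` Hausdorff without boundary over a complete model,
`G (t, y) ∈ T_y N` smooth on `ℝ × N`, vanishing for `t ∉ [a, b]` and for `y ∉ K`, `K` compact;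
conclusion: an ambient isotopy `Ψ` of `N` all of whose tracks `s ↦ (s, Ψ_s y)` are integral curves
of the suspension field `(1, G)`. [cite: HirschDT1976, Ch. 8 §1, Thms. 1.1–1.2] -/
theorem exists_ambientIsotopy_of_timeDependent_of_isCompact [CompleteSpace EN]
    {G : Π p : ℝ × N, TangentSpace J p.2}
    (hG : ContMDiff (𝓘(ℝ, ℝ).prod J) J.tangent ∞
      fun p : ℝ × N => (⟨p.2, G p⟩ : TangentBundle J N))
    {K : Set N} (hK : IsCompact K)
    (hsupp : ∀ p : ℝ × N, (p.1 ∉ Icc a b ∨ p.2 ∉ K) → G p = 0) :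
    ∃ Ψ : AmbientIsotopy J N, ∀ y, IsMIntegralCurve (I := 𝓘(ℝ, ℝ).prod J)
      (fun s => ((s, Ψ.toFun s y) : ℝ × N))
      (fun p : ℝ × N => (((1 : ℝ), G p) : TangentSpace (𝓘(ℝ, ℝ).prod J) p)) := by
  have hX := contMDiff_suspension hG
  have hX1 : ∀ p : ℝ × N,
      ((fun p : ℝ × N => (((1 : ℝ), G p) : TangentSpace (𝓘(ℝ, ℝ).prod J) p)) p).1 = 1 :=
    fun _ => rfl
  obtain ⟨ε, hε, hu⟩ := hasUniformLocalFlow_suspension_of_isCompact hX hX1 hK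
    fun p hp => hsupp p hp
  exact ⟨suspensionIsotopy hX hX1 hε hu, isMIntegralCurve_suspensionIsotopy hX hX1 hε hu⟩

/-- **Zeros of the field do not move**: if `G (t, y) = 0` for all `t`, every stage of an
ambient isotopy whose tracks are integral curves of `(1, G)` fixes `y`.
[cite: HirschDT1976, Ch. 8 §1, Thm. 1.1] -/
theorem apply_eq_self_of_forall_eq_zero {G : Π p : ℝ × N, TangentSpace J p.2}
    (hG : ContMDiff (𝓘(ℝ, ℝ).prod J) J.tangent ∞
      fun p : ℝ × N => (⟨p.2, G p⟩ : TangentBundle J N))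
    {Ψ : AmbientIsotopy J N}
    (hΨ : ∀ y, IsMIntegralCurve (I := 𝓘(ℝ, ℝ).prod J) (fun s => ((s, Ψ.toFun s y) : ℝ × N))
      (fun p : ℝ × N => (((1 : ℝ), G p) : TangentSpace (𝓘(ℝ, ℝ).prod J) p)))
    {y : N} (hy : ∀ t, G (t, y) = 0) (t : ℝ) : Ψ.toFun t y = y := by
  have hX := contMDiff_suspension hG
  have hX1 : ∀ p : ℝ × N,
      ((fun p : ℝ × N => (((1 : ℝ), G p) : TangentSpace (𝓘(ℝ, ℝ).prod J) p)) p).1 = 1 :=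
    fun _ => rfl
  -- the stationary track `s ↦ (s, y)` is an integral curve
  have hγ' : IsMIntegralCurveOn (I := 𝓘(ℝ, ℝ).prod J)
      (fun s => (((((0 : ℝ), y) : ℝ × N).1 + s, (((0 : ℝ), y) : ℝ × N).2) : ℝ × N))
      (fun p : ℝ × N => (((1 : ℝ), G p) : TangentSpace (𝓘(ℝ, ℝ).prod J) p))
      (Ioo (-(|t| + 1)) (|t| + 1)) := by
    intro s _
    have hy' : ((fun p : ℝ × N => (((1 : ℝ), G p) : TangentSpace (𝓘(ℝ, ℝ).prod J) p))
        ((((0 : ℝ), y) : ℝ × N).1 + s, (((0 : ℝ), y) : ℝ × N).2)).2 = 0 := by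
      show G (0 + s, y) = 0
      exact hy (0 + s)
    exact (hasMFDerivAt_horizontal (J := J) (N := N) (X := fun p : ℝ × N =>
      (((1 : ℝ), G p) : TangentSpace (𝓘(ℝ, ℝ).prod J) p)) hX1 (p := ((0 : ℝ), y)) (s := s)
      hy').hasMFDerivWithinAt
  have he : (fun s => (((((0 : ℝ), y) : ℝ × N).1 + s, (((0 : ℝ), y) : ℝ × N).2) : ℝ × N)) =
      fun s => ((s, y) : ℝ × N) := by
    funext s; simp
  have hγ : IsMIntegralCurveOn (I := 𝓘(ℝ, ℝ).prod J) (fun s => ((s, y) : ℝ × N))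
      (fun p : ℝ × N => (((1 : ℝ), G p) : TangentSpace (𝓘(ℝ, ℝ).prod J) p))
      (Ioo (-(|t| + 1)) (|t| + 1)) := by
    rw [← he]; exact hγ'
  have h0 : (0 : ℝ) ∈ Ioo (-(|t| + 1)) (|t| + 1) := by constructor <;> linarith [abs_nonneg t]
  have ht : t ∈ Ioo (-(|t| + 1)) (|t| + 1) := by
    constructor <;> linarith [abs_nonneg t, le_abs_self t, neg_abs_le t]
  have := AmbientIsotopy.eq_of_isMIntegralCurveOn_track (hX.of_le (by norm_cast)) hΨ h0 hγ ht
  exact this.symm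

/-- **Tracks are carried by the isotopy**: if the track `s ↦ (s, γ s)` of a curve `γ` is an
integral curve of `(1, G)` on an open interval containing `0` and `s`, then `γ s = Ψ_s (γ 0)`.
[cite: HirschDT1976, Ch. 8 §1, Thm. 1.1] -/
theorem apply_eq_of_track {G : Π p : ℝ × N, TangentSpace J p.2}
    (hG : ContMDiff (𝓘(ℝ, ℝ).prod J) J.tangent ∞
      fun p : ℝ × N => (⟨p.2, G p⟩ : TangentBundle J N))
    {Ψ : AmbientIsotopy J N}
    (hΨ : ∀ y, IsMIntegralCurve (I := 𝓘(ℝ, ℝ).prod J) (fun s => ((s, Ψ.toFun s y) : ℝ × N))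
      (fun p : ℝ × N => (((1 : ℝ), G p) : TangentSpace (𝓘(ℝ, ℝ).prod J) p)))
    {γ : ℝ → N} {c d : ℝ} (h0 : (0 : ℝ) ∈ Ioo c d)
    (hγ : IsMIntegralCurveOn (I := 𝓘(ℝ, ℝ).prod J) (fun s => ((s, γ s) : ℝ × N))
      (fun p : ℝ × N => (((1 : ℝ), G p) : TangentSpace (𝓘(ℝ, ℝ).prod J) p)) (Ioo c d))
    {s : ℝ} (hs : s ∈ Ioo c d) : γ s = Ψ.toFun s (γ 0) :=
  AmbientIsotopy.eq_of_isMIntegralCurveOn_track ((contMDiff_suspension hG).of_le (by norm_cast))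
    hΨ h0 hγ hs

end SlabFlow

end Literature.Topology.FourManifolds
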